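import Mathlib
import Summits.NavierStokesRegularity.NavierStokesRegularity.Theses.TypeIIInviscidRelaxation
import Literature.Analysis.FluidPDE.TypeIICoreWitness
import Literature.Analysis.FluidPDE.ClassicalSolutionCalculus
import HarnessLib

/-!
# Cruxes `ColumnarCoreExclusion` (stmt-1966) / `MonopoleCoreExclusion` (stmt-1965): the registered lines are
# CONSISTENT relative to no-blow-up — every open stub, verbatim, follows from the route's no-blow-up antecedent

`--supports stmt-NavierStokesRegularity-1966` (helper file; theorems only, no definitions, no `sorry`; class-free parts
serve stmt-1965 verbatim).

The two registered LINE-FIRST skeletons `Cruxes/ColumnarCoreExclusion/Lines/columnar_comparison_flow.lean` (812bbbce) and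
`Cruxes/MonopoleCoreExclusion/Lines/axisymmetric_comparison_flow.lean` (dd3458b3) each have two open stubs: the [L]
anchors `stub_anchoredLateColumnarWitness` / `stub_anchoredLateAxisymWitness` and the [XL] finite-horizon shadowing
statements `stub_columnarShadowing` / `stub_axisymShadowing`.  Seven prover hands found no in-tree proof and no in-tree
refutation.  This file records, in kernel and BY THE REGISTERED SIGNATURES, why no refuter can kill any of the four
without constructing a finite-time singularity, and what the shadowing stubs say pointwise in the solution:

* `localBound_of_hasSmoothExtensionPast` — the POINTWISE UPPER SANDWICH: for a fixed field `u`, the conclusion of both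
  shadowing stubs («`u` bounded on `[t,T) × B(x₀,r)`») follows from `HasSmoothExtensionPast ν 0 u T` alone (the
  continuation is continuous on the compact `[t,T] × B̄(x₀,r)`); no comparison flow, no lateness, no Reynolds number.
* `isMaximalSmoothSolution_of_locallyUnbounded` — the POINTWISE LOWER SANDWICH: a classical solution on `[0,T)` violating
  that conclusion on one ball is a maximal smooth solution with lifespan `T` (a blow-up at `T`).
* `columnarShadowing_of_noBlowup`, `axisymShadowing_of_noBlowup`, `anchoredLateColumnarWitness_of_noBlowup`,
  `anchoredLateAxisymWitness_of_noBlowup` — each of the FOUR open registered stubs, statement VERBATIM, from the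
  no-blow-up antecedent `NB` of the route item `NoBlowupToClay` (stmt-0055: classical on `[0,T)`, Leray–Hopf from a
  rapidly decaying datum ⇒ `HasSmoothExtensionPast`); the anchors vacuously (their hypothesis `IsMaximalSmoothSolution`
  contradicts `NB`), the shadowings with `K₀ = 1`.
* `columnarCoreExclusion_of_noBlowup`, `monopoleCoreExclusion_of_noBlowup` — the two cruxes BY NAME from `NB`.
* `columnarShadowing_iff_blowupForm`, `axisymShadowing_iff_blowupForm` — each shadowing stub is EQUIVALENT in kernel to
  its restriction to solutions with NO smooth extension past `T` (the registered statement with the single extra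
  hypothesis `¬ HasSmoothExtensionPast ν 0 u T`): the stub is exactly a statement about blow-up solutions — «a solution
  singular at `T` carrying at a late time `t` a bounded exactly columnar (resp. axisymmetric) classical flow
  `A·V/K`-close on the core ball does not blow up inside `B(x₀, 3KL/8)` (resp. `B(x₀, KL/2)`)».

Consequences for the planner / refuter (honest framing).  (i) `NB ⇒` every stub of both lines `⇒` (kernel compositions
`ColumnarCoreExclusion_of`, `MonopoleCoreExclusion_of`) both cruxes: the lines are consistent relative to `NB`, so an
in-tree refutation of ANY of the four open stubs is a proof of `¬NB`, i.e. an explicit finite-time singularity from a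
rapidly decaying datum.  (ii) The [XL] stubs carry no content on non-singular solutions; their content is the blow-up
form.  Nothing here is evidence for or against Navier–Stokes regularity; no stub is closed by name; rung 0.
-/

noncomputable section

open Set Metric Function
open Literature.Analysis Literature.Analysis.FluidPDE

namespace Summit.NavierStokesRegularity.NavierStokesRegularity.Theorems

-- the problem directory repeats the summit name (`NavierStokesRegularity/NavierStokesRegularity`)
set_option linter.dupNamespace false

namespace CoreExclusionConsistency

/-! ## The pointwise sandwich of the shadowing conclusion -/

/-- **Pointwise upper sandwich.**  If the field `u` extends smoothly past `T` (`HasSmoothExtensionPast ν f u T`), then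
for every `0 ≤ t`, every centre `x₀` and radius `r`, `u` is bounded on `[t, T) × B(x₀, r)`: the continuation `u'` is a
classical solution on `[0, T')`, `T' > T`, hence continuous on the compact `[t, T] × B̄(x₀, r) ⊆ [0, T') × ℝ³`, and it
agrees with `u` on `[0, T)`.  This is the conclusion of both registered shadowing stubs, obtained with none of their
dynamical hypotheses. [folklore] -/
theorem localBound_of_hasSmoothExtensionPast {ν T t : ℝ}
    {f u : ℝ → EuclideanSpace ℝ (Fin 3) → EuclideanSpace ℝ (Fin 3)}
    (hext : HasSmoothExtensionPast ν f u T) (ht : 0 ≤ t) (x₀ : EuclideanSpace ℝ (Fin 3)) (r : ℝ) :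
    ∃ M : ℝ, ∀ s ∈ Ico t T, ∀ x ∈ ball x₀ r, ‖u s x‖ ≤ M := by
  obtain ⟨T', hTT', u', p', hcl', hagree⟩ := hext
  set K : Set (ℝ × EuclideanSpace ℝ (Fin 3)) := Icc t T ×ˢ closedBall x₀ r with hK_def
  have hK : IsCompact K := isCompact_Icc.prod (isCompact_closedBall _ _)
  have hKsub : K ⊆ Ico 0 T' ×ˢ (univ : Set (EuclideanSpace ℝ (Fin 3))) :=
    prod_mono (fun s hs => ⟨ht.trans hs.1, hs.2.trans_lt hTT'⟩) (subset_univ _)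
  have hcont : ContinuousOn (uncurry u') K := hcl'.smooth_velocity.continuousOn.mono hKsub
  obtain ⟨M, hM⟩ := hK.exists_bound_of_continuousOn hcont
  refine ⟨M, fun s hs x hx => ?_⟩
  have hsx : (s, x) ∈ K := ⟨⟨hs.1, hs.2.le⟩, mem_closedBall.2 (le_of_lt (mem_ball.1 hx))⟩
  have heq : u s x = uncurry u' (s, x) := by
    simp only [uncurry_apply_pair, hagree s ⟨ht.trans hs.1, hs.2⟩]
  rw [heq]
  exact hM _ hsx

/-- **Pointwise lower sandwich.**  A classical solution on `[0, T)` that is unbounded on `[t, T) × B(x₀, r)` for some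
`0 ≤ t` has no smooth extension past `T`, i.e. it is a maximal smooth solution with lifespan `T` (a blow-up at `T`).
[folklore] -/
theorem isMaximalSmoothSolution_of_locallyUnbounded {ν T t : ℝ}
    {f u : ℝ → EuclideanSpace ℝ (Fin 3) → EuclideanSpace ℝ (Fin 3)} {p : ℝ → EuclideanSpace ℝ (Fin 3) → ℝ}
    (hcl : IsClassicalNSSolutionOn (Ico 0 T) ν f u p) (ht : 0 ≤ t) {x₀ : EuclideanSpace ℝ (Fin 3)} {r : ℝ}
    (hunb : ¬ ∃ M : ℝ, ∀ s ∈ Ico t T, ∀ x ∈ ball x₀ r, ‖u s x‖ ≤ M) :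
    IsMaximalSmoothSolution ν f u p T :=
  ⟨hcl, fun hext => hunb (localBound_of_hasSmoothExtensionPast hext ht x₀ r)⟩

/-! ## The four open registered stubs, verbatim, from the no-blow-up antecedent `NB` -/

/-- **`stub_columnarShadowing` ⟸ NB** (line `columnar_comparison_flow` of stmt-1966, registered signature VERBATIM as
the conclusion).  From the no-blow-up antecedent of `NoBlowupToClay` the stub holds with `K₀ = 1`: the solution extends
past `T`, so `localBound_of_hasSmoothExtensionPast` bounds it on `[t,T) × B(x₀, 3KL/8)`; the comparison flow, the
lateness, the Reynolds number and the closeness are not used. [folklore] -/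
theorem columnarShadowing_of_noBlowup
    (hNB : ∀ (ν T : ℝ), 0 < ν → 0 < T →
      ∀ (u : ℝ → EuclideanSpace ℝ (Fin 3) → EuclideanSpace ℝ (Fin 3)) (p : ℝ → EuclideanSpace ℝ (Fin 3) → ℝ),
        IsClassicalNSSolutionOn (Set.Ico 0 T) ν 0 u p → IsLerayHopfOn T ν 0 (u 0) u →
        HasRapidSpatialDecay (u 0) → HasSmoothExtensionPast ν 0 u T) :
    ∀ A : ℝ, 0 < A → ∃ K₀ : ℝ, 1 ≤ K₀ ∧ ∀ K : ℝ, K₀ ≤ K →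
      ∀ (ν T t : ℝ) (u : ℝ → EuclideanSpace ℝ (Fin 3) → EuclideanSpace ℝ (Fin 3))
        (p : ℝ → EuclideanSpace ℝ (Fin 3) → ℝ),
        0 < ν → 0 < T → IsClassicalNSSolutionOn (Ico 0 T) ν 0 u p → IsLerayHopfOn T ν 0 (u 0) u →
        HasRapidSpatialDecay (u 0) → 0 < t → t < T →
        ∀ (x₀ : EuclideanSpace ℝ (Fin 3)) (L V : ℝ)
          (Q : EuclideanSpace ℝ (Fin 3) ≃ₗᵢ[ℝ] EuclideanSpace ℝ (Fin 3)),
          0 < L → 0 < V → (∀ x, ‖u t x‖ ≤ V) →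
          (∃ x₁, dist x₁ x₀ ≤ L ∧ V ≤ 2 * ‖u t x₁‖) → K * ν ≤ L * V → (T - t) * V ≤ K * L →
          ∀ (v : ℝ → EuclideanSpace ℝ (Fin 3) → EuclideanSpace ℝ (Fin 3))
            (q : ℝ → EuclideanSpace ℝ (Fin 3) → ℝ) (Mv : ℝ),
            IsClassicalNSSolutionOn (Icc t T) ν 0 v q →
            (∀ s ∈ Icc t T, ∀ (x : EuclideanSpace ℝ (Fin 3)) (τ : ℝ), v s (x + τ • Q eZ) = v s x) →
            (∀ s ∈ Icc t T, ∀ x, ‖v s x‖ ≤ Mv) →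
            (∀ x ∈ ball x₀ (K * L / 2), ‖u t x - v t x‖ ≤ A * V / K) →
            ∃ M : ℝ, ∀ s ∈ Ico t T, ∀ x ∈ ball x₀ (3 * K * L / 8), ‖u s x‖ ≤ M := by
  intro A _
  refine ⟨1, le_rfl, ?_⟩
  intro K _ ν T t u p hν hT hcl hLH hdec ht _ x₀ L _ _ _ _ _ _ _ _ _ _ _ _ _ _ _
  exact localBound_of_hasSmoothExtensionPast (hNB ν T hν hT u p hcl hLH hdec) ht.le x₀ (3 * K * L / 8)

/-- **`stub_axisymShadowing` ⟸ NB** (line `axisymmetric_comparison_flow` of stmt-1965, registered signature VERBATIM as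
the conclusion), with `K₀ = 1`, by `localBound_of_hasSmoothExtensionPast` on `B(x₀, KL/2)`. [folklore] -/
theorem axisymShadowing_of_noBlowup
    (hNB : ∀ (ν T : ℝ), 0 < ν → 0 < T →
      ∀ (u : ℝ → EuclideanSpace ℝ (Fin 3) → EuclideanSpace ℝ (Fin 3)) (p : ℝ → EuclideanSpace ℝ (Fin 3) → ℝ),
        IsClassicalNSSolutionOn (Set.Ico 0 T) ν 0 u p → IsLerayHopfOn T ν 0 (u 0) u →
        HasRapidSpatialDecay (u 0) → HasSmoothExtensionPast ν 0 u T) :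
    ∀ A : ℝ, 0 < A → ∃ K₀ : ℝ, 1 ≤ K₀ ∧ ∀ K : ℝ, K₀ ≤ K →
      ∀ (ν T t : ℝ) (u : ℝ → EuclideanSpace ℝ (Fin 3) → EuclideanSpace ℝ (Fin 3))
        (p : ℝ → EuclideanSpace ℝ (Fin 3) → ℝ),
        0 < ν → 0 < T → IsClassicalNSSolutionOn (Ico 0 T) ν 0 u p → IsLerayHopfOn T ν 0 (u 0) u →
        HasRapidSpatialDecay (u 0) → 0 < t → t < T →
        ∀ (x₀ : EuclideanSpace ℝ (Fin 3)) (L V : ℝ)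
          (Q : EuclideanSpace ℝ (Fin 3) ≃ₗᵢ[ℝ] EuclideanSpace ℝ (Fin 3)),
          0 < L → 0 < V → (∀ x, ‖u t x‖ ≤ V) →
          (∃ x₁, dist x₁ x₀ ≤ L ∧ V ≤ 2 * ‖u t x₁‖) → K * ν ≤ L * V → (T - t) * V ≤ K * L →
          ∀ (v : ℝ → EuclideanSpace ℝ (Fin 3) → EuclideanSpace ℝ (Fin 3))
            (q : ℝ → EuclideanSpace ℝ (Fin 3) → ℝ) (Mv : ℝ),
            IsClassicalNSSolutionOn (Icc t T) ν 0 v q →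
            (∀ s ∈ Icc t T, IsAxisymmetric (fun y : EuclideanSpace ℝ (Fin 3) => Q.symm (v s (x₀ + Q y)))) →
            (∀ s ∈ Icc t T, ∀ x, ‖v s x‖ ≤ Mv) →
            (∀ x ∈ ball x₀ (K * L), ‖u t x - v t x‖ ≤ A * V / K) →
            ∃ M : ℝ, ∀ s ∈ Ico t T, ∀ x ∈ ball x₀ (K * L / 2), ‖u s x‖ ≤ M := by
  intro A _
  refine ⟨1, le_rfl, ?_⟩
  intro K _ ν T t u p hν hT hcl hLH hdec ht _ x₀ L _ _ _ _ _ _ _ _ _ _ _ _ _ _ _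
  exact localBound_of_hasSmoothExtensionPast (hNB ν T hν hT u p hcl hLH hdec) ht.le x₀ (K * L / 2)

/-- **`stub_anchoredLateColumnarWitness` ⟸ NB** (line `columnar_comparison_flow` of stmt-1966, registered signature
VERBATIM): vacuous, since the stub's hypothesis `IsMaximalSmoothSolution ν 0 u p T` (no smooth extension past `T`)
contradicts `NB` applied to the same classical Leray–Hopf solution with rapidly decaying datum. [folklore] -/
theorem anchoredLateColumnarWitness_of_noBlowup
    (hNB : ∀ (ν T : ℝ), 0 < ν → 0 < T →
      ∀ (u : ℝ → EuclideanSpace ℝ (Fin 3) → EuclideanSpace ℝ (Fin 3)) (p : ℝ → EuclideanSpace ℝ (Fin 3) → ℝ),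
        IsClassicalNSSolutionOn (Set.Ico 0 T) ν 0 u p → IsLerayHopfOn T ν 0 (u 0) u →
        HasRapidSpatialDecay (u 0) → HasSmoothExtensionPast ν 0 u T)
    {ν T : ℝ} {u : ℝ → EuclideanSpace ℝ (Fin 3) → EuclideanSpace ℝ (Fin 3)}
    {p : ℝ → EuclideanSpace ℝ (Fin 3) → ℝ}
    (hν : 0 < ν) (hT : 0 < T) (hmax : IsMaximalSmoothSolution ν 0 u p T)
    (hLH : IsLerayHopfOn T ν 0 (u 0) u) (hdec : HasRapidSpatialDecay (u 0))
    (_hnI : ¬ IsTypeIBlowup u T)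
    (_hw : ∀ K : ℝ, 0 < K → ∀ t₀ < T, ∃ t, t₀ < t ∧ t < T ∧ TypeIICoreWitness IsColumnar ν K u t) :
    ∃ xs : EuclideanSpace ℝ (Fin 3),
      (¬ ∃ ρ M : ℝ, 0 < ρ ∧ ∀ s ∈ Ioo (T - ρ ^ 2) T, ∀ x ∈ ball xs ρ, ‖u s x‖ ≤ M) ∧
      ∀ K : ℝ, 0 < K → ∃ t : ℝ, 0 < t ∧ t < T ∧
        ∃ (x₀ : EuclideanSpace ℝ (Fin 3)) (L V : ℝ)
          (Q : EuclideanSpace ℝ (Fin 3) ≃ₗᵢ[ℝ] EuclideanSpace ℝ (Fin 3))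
          (W : EuclideanSpace ℝ (Fin 3) → EuclideanSpace ℝ (Fin 3)),
          0 < L ∧ 0 < V ∧ IsColumnar W ∧ (∀ x, ‖u t x‖ ≤ V) ∧
          (∃ x₁, dist x₁ x₀ ≤ L ∧ V ≤ 2 * ‖u t x₁‖) ∧
          (∃ y y' : EuclideanSpace ℝ (Fin 3), ‖y‖ ≤ 1 ∧ ‖y'‖ ≤ 1 ∧ (4 : ℝ)⁻¹ ≤ ‖W y - W y'‖) ∧
          K * ν ≤ L * V ∧
          (∀ y : EuclideanSpace ℝ (Fin 3), ‖y‖ ≤ K →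
            ‖V⁻¹ • Q.symm (u t (x₀ + L • Q y)) - W y‖ ≤ K⁻¹) ∧
          (T - t) * V ≤ K * L ∧ dist xs x₀ ≤ K * L / 4 :=
  (hmax.2 (hNB ν T hν hT u p hmax.1 hLH hdec)).elim

/-- **`stub_anchoredLateAxisymWitness` ⟸ NB** (line `axisymmetric_comparison_flow` of stmt-1965, registered signature
VERBATIM): vacuous for the same reason. [folklore] -/
theorem anchoredLateAxisymWitness_of_noBlowup
    (hNB : ∀ (ν T : ℝ), 0 < ν → 0 < T →
      ∀ (u : ℝ → EuclideanSpace ℝ (Fin 3) → EuclideanSpace ℝ (Fin 3)) (p : ℝ → EuclideanSpace ℝ (Fin 3) → ℝ),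
        IsClassicalNSSolutionOn (Set.Ico 0 T) ν 0 u p → IsLerayHopfOn T ν 0 (u 0) u →
        HasRapidSpatialDecay (u 0) → HasSmoothExtensionPast ν 0 u T)
    {ν T : ℝ} {u : ℝ → EuclideanSpace ℝ (Fin 3) → EuclideanSpace ℝ (Fin 3)}
    {p : ℝ → EuclideanSpace ℝ (Fin 3) → ℝ}
    (hν : 0 < ν) (hT : 0 < T) (hmax : IsMaximalSmoothSolution ν 0 u p T)
    (hLH : IsLerayHopfOn T ν 0 (u 0) u) (hdec : HasRapidSpatialDecay (u 0))
    (_hnI : ¬ IsTypeIBlowup u T)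
    (_hw : ∀ K : ℝ, 0 < K → ∀ t₀ < T, ∃ t, t₀ < t ∧ t < T ∧ TypeIICoreWitness IsAxisymmetric ν K u t) :
    ∃ xs : EuclideanSpace ℝ (Fin 3),
      (¬ ∃ ρ M : ℝ, 0 < ρ ∧ ∀ s ∈ Ioo (T - ρ ^ 2) T, ∀ x ∈ ball xs ρ, ‖u s x‖ ≤ M) ∧
      ∀ K : ℝ, 0 < K → ∃ t : ℝ, 0 < t ∧ t < T ∧
        ∃ (x₀ : EuclideanSpace ℝ (Fin 3)) (L V : ℝ)
          (Q : EuclideanSpace ℝ (Fin 3) ≃ₗᵢ[ℝ] EuclideanSpace ℝ (Fin 3))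
          (W : EuclideanSpace ℝ (Fin 3) → EuclideanSpace ℝ (Fin 3)),
          0 < L ∧ 0 < V ∧ IsAxisymmetric W ∧ (∀ x, ‖u t x‖ ≤ V) ∧
          (∃ x₁, dist x₁ x₀ ≤ L ∧ V ≤ 2 * ‖u t x₁‖) ∧
          (∃ y y' : EuclideanSpace ℝ (Fin 3), ‖y‖ ≤ 1 ∧ ‖y'‖ ≤ 1 ∧ (4 : ℝ)⁻¹ ≤ ‖W y - W y'‖) ∧
          K * ν ≤ L * V ∧
          (∀ y : EuclideanSpace ℝ (Fin 3), ‖y‖ ≤ K →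
            ‖V⁻¹ • Q.symm (u t (x₀ + L • Q y)) - W y‖ ≤ K⁻¹) ∧
          (T - t) * V ≤ K * L ∧ dist xs x₀ ≤ K * L / 4 :=
  (hmax.2 (hNB ν T hν hT u p hmax.1 hLH hdec)).elim

/-! ## The two cruxes by name from `NB` -/

/-- **`ColumnarCoreExclusion` ⟸ NB** (route decl of stmt-1966 BY NAME): a maximal smooth solution contradicts `NB`.
[folklore] -/
theorem columnarCoreExclusion_of_noBlowup
    (hNB : ∀ (ν T : ℝ), 0 < ν → 0 < T →
      ∀ (u : ℝ → EuclideanSpace ℝ (Fin 3) → EuclideanSpace ℝ (Fin 3)) (p : ℝ → EuclideanSpace ℝ (Fin 3) → ℝ),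
        IsClassicalNSSolutionOn (Set.Ico 0 T) ν 0 u p → IsLerayHopfOn T ν 0 (u 0) u →
        HasRapidSpatialDecay (u 0) → HasSmoothExtensionPast ν 0 u T) :
    Summit.NavierStokesRegularity.NavierStokesRegularity.Theses.TypeIIInviscidRelaxation.ColumnarCoreExclusion :=
  fun ν T hν hT u p hmax hLH hdec _ _ => hmax.2 (hNB ν T hν hT u p hmax.1 hLH hdec)

/-- **`MonopoleCoreExclusion` ⟸ NB** (route decl of stmt-1965 BY NAME; its own hypothesis `AxisymSwirlRegular` is not
used): a maximal smooth solution contradicts `NB`. [folklore] -/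
theorem monopoleCoreExclusion_of_noBlowup
    (hNB : ∀ (ν T : ℝ), 0 < ν → 0 < T →
      ∀ (u : ℝ → EuclideanSpace ℝ (Fin 3) → EuclideanSpace ℝ (Fin 3)) (p : ℝ → EuclideanSpace ℝ (Fin 3) → ℝ),
        IsClassicalNSSolutionOn (Set.Ico 0 T) ν 0 u p → IsLerayHopfOn T ν 0 (u 0) u →
        HasRapidSpatialDecay (u 0) → HasSmoothExtensionPast ν 0 u T) :
    Summit.NavierStokesRegularity.NavierStokesRegularity.Theses.TypeIIInviscidRelaxation.MonopoleCoreExclusion :=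
  fun _ ν T hν hT u p hmax hLH hdec _ _ => hmax.2 (hNB ν T hν hT u p hmax.1 hLH hdec)

/-! ## The blow-up form of the shadowing stubs (kernel equivalence) -/

/-- **Blow-up form of `stub_columnarShadowing`.**  The registered [XL] stub (left) is equivalent to its restriction to
solutions WITHOUT smooth extension past `T` (right: the same statement with the one extra hypothesis
`¬ HasSmoothExtensionPast ν 0 u T` after `t < T`).  `→`: drop the hypothesis.  `←`: if `u` extends past `T` the
conclusion is `localBound_of_hasSmoothExtensionPast`; otherwise apply the right-hand side.  So the stub's whole
content concerns blow-up solutions: «a solution singular at `T` that carries at a late time a bounded exactly columnar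
classical flow `A·V/K`-close on `B(x₀, KL/2)` does not blow up inside `B(x₀, 3KL/8)`». [folklore] -/
theorem columnarShadowing_iff_blowupForm :
    (∀ A : ℝ, 0 < A → ∃ K₀ : ℝ, 1 ≤ K₀ ∧ ∀ K : ℝ, K₀ ≤ K →
      ∀ (ν T t : ℝ) (u : ℝ → EuclideanSpace ℝ (Fin 3) → EuclideanSpace ℝ (Fin 3))
        (p : ℝ → EuclideanSpace ℝ (Fin 3) → ℝ),
        0 < ν → 0 < T → IsClassicalNSSolutionOn (Ico 0 T) ν 0 u p → IsLerayHopfOn T ν 0 (u 0) u →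
        HasRapidSpatialDecay (u 0) → 0 < t → t < T →
        ∀ (x₀ : EuclideanSpace ℝ (Fin 3)) (L V : ℝ)
          (Q : EuclideanSpace ℝ (Fin 3) ≃ₗᵢ[ℝ] EuclideanSpace ℝ (Fin 3)),
          0 < L → 0 < V → (∀ x, ‖u t x‖ ≤ V) →
          (∃ x₁, dist x₁ x₀ ≤ L ∧ V ≤ 2 * ‖u t x₁‖) → K * ν ≤ L * V → (T - t) * V ≤ K * L →
          ∀ (v : ℝ → EuclideanSpace ℝ (Fin 3) → EuclideanSpace ℝ (Fin 3))
            (q : ℝ → EuclideanSpace ℝ (Fin 3) → ℝ) (Mv : ℝ),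
            IsClassicalNSSolutionOn (Icc t T) ν 0 v q →
            (∀ s ∈ Icc t T, ∀ (x : EuclideanSpace ℝ (Fin 3)) (τ : ℝ), v s (x + τ • Q eZ) = v s x) →
            (∀ s ∈ Icc t T, ∀ x, ‖v s x‖ ≤ Mv) →
            (∀ x ∈ ball x₀ (K * L / 2), ‖u t x - v t x‖ ≤ A * V / K) →
            ∃ M : ℝ, ∀ s ∈ Ico t T, ∀ x ∈ ball x₀ (3 * K * L / 8), ‖u s x‖ ≤ M) ↔
    (∀ A : ℝ, 0 < A → ∃ K₀ : ℝ, 1 ≤ K₀ ∧ ∀ K : ℝ, K₀ ≤ K →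
      ∀ (ν T t : ℝ) (u : ℝ → EuclideanSpace ℝ (Fin 3) → EuclideanSpace ℝ (Fin 3))
        (p : ℝ → EuclideanSpace ℝ (Fin 3) → ℝ),
        0 < ν → 0 < T → IsClassicalNSSolutionOn (Ico 0 T) ν 0 u p → IsLerayHopfOn T ν 0 (u 0) u →
        HasRapidSpatialDecay (u 0) → 0 < t → t < T → ¬ HasSmoothExtensionPast ν 0 u T →
        ∀ (x₀ : EuclideanSpace ℝ (Fin 3)) (L V : ℝ)
          (Q : EuclideanSpace ℝ (Fin 3) ≃ₗᵢ[ℝ] EuclideanSpace ℝ (Fin 3)),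
          0 < L → 0 < V → (∀ x, ‖u t x‖ ≤ V) →
          (∃ x₁, dist x₁ x₀ ≤ L ∧ V ≤ 2 * ‖u t x₁‖) → K * ν ≤ L * V → (T - t) * V ≤ K * L →
          ∀ (v : ℝ → EuclideanSpace ℝ (Fin 3) → EuclideanSpace ℝ (Fin 3))
            (q : ℝ → EuclideanSpace ℝ (Fin 3) → ℝ) (Mv : ℝ),
            IsClassicalNSSolutionOn (Icc t T) ν 0 v q →
            (∀ s ∈ Icc t T, ∀ (x : EuclideanSpace ℝ (Fin 3)) (τ : ℝ), v s (x + τ • Q eZ) = v s x) →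
            (∀ s ∈ Icc t T, ∀ x, ‖v s x‖ ≤ Mv) →
            (∀ x ∈ ball x₀ (K * L / 2), ‖u t x - v t x‖ ≤ A * V / K) →
            ∃ M : ℝ, ∀ s ∈ Ico t T, ∀ x ∈ ball x₀ (3 * K * L / 8), ‖u s x‖ ≤ M) := by
  constructor
  · intro h A hA
    obtain ⟨K₀, hK₀, hK⟩ := h A hA
    refine ⟨K₀, hK₀, ?_⟩
    intro K hKK ν T t u p hν hT hcl hLH hdec ht htT _ x₀ L V Q hL hV hbd hnear hRe hlate v q Mv hv hvcol hvbd
      hclose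
    exact hK K hKK ν T t u p hν hT hcl hLH hdec ht htT x₀ L V Q hL hV hbd hnear hRe hlate v q Mv hv hvcol hvbd
      hclose
  · intro h A hA
    obtain ⟨K₀, hK₀, hK⟩ := h A hA
    refine ⟨K₀, hK₀, ?_⟩
    intro K hKK ν T t u p hν hT hcl hLH hdec ht htT x₀ L V Q hL hV hbd hnear hRe hlate v q Mv hv hvcol hvbd hclose
    by_cases hext : HasSmoothExtensionPast ν 0 u T
    · exact localBound_of_hasSmoothExtensionPast hext ht.le x₀ (3 * K * L / 8)
    · exact hK K hKK ν T t u p hν hT hcl hLH hdec ht htT hext x₀ L V Q hL hV hbd hnear hRe hlate v q Mv hv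
        hvcol hvbd hclose

/-- **Blow-up form of `stub_axisymShadowing`** (stmt-1965): the registered stub is equivalent to its restriction to
solutions without smooth extension past `T`. [folklore] -/
theorem axisymShadowing_iff_blowupForm :
    (∀ A : ℝ, 0 < A → ∃ K₀ : ℝ, 1 ≤ K₀ ∧ ∀ K : ℝ, K₀ ≤ K →
      ∀ (ν T t : ℝ) (u : ℝ → EuclideanSpace ℝ (Fin 3) → EuclideanSpace ℝ (Fin 3))
        (p : ℝ → EuclideanSpace ℝ (Fin 3) → ℝ),
        0 < ν → 0 < T → IsClassicalNSSolutionOn (Ico 0 T) ν 0 u p → IsLerayHopfOn T ν 0 (u 0) u →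
        HasRapidSpatialDecay (u 0) → 0 < t → t < T →
        ∀ (x₀ : EuclideanSpace ℝ (Fin 3)) (L V : ℝ)
          (Q : EuclideanSpace ℝ (Fin 3) ≃ₗᵢ[ℝ] EuclideanSpace ℝ (Fin 3)),
          0 < L → 0 < V → (∀ x, ‖u t x‖ ≤ V) →
          (∃ x₁, dist x₁ x₀ ≤ L ∧ V ≤ 2 * ‖u t x₁‖) → K * ν ≤ L * V → (T - t) * V ≤ K * L →
          ∀ (v : ℝ → EuclideanSpace ℝ (Fin 3) → EuclideanSpace ℝ (Fin 3))
            (q : ℝ → EuclideanSpace ℝ (Fin 3) → ℝ) (Mv : ℝ),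
            IsClassicalNSSolutionOn (Icc t T) ν 0 v q →
            (∀ s ∈ Icc t T, IsAxisymmetric (fun y : EuclideanSpace ℝ (Fin 3) => Q.symm (v s (x₀ + Q y)))) →
            (∀ s ∈ Icc t T, ∀ x, ‖v s x‖ ≤ Mv) →
            (∀ x ∈ ball x₀ (K * L), ‖u t x - v t x‖ ≤ A * V / K) →
            ∃ M : ℝ, ∀ s ∈ Ico t T, ∀ x ∈ ball x₀ (K * L / 2), ‖u s x‖ ≤ M) ↔
    (∀ A : ℝ, 0 < A → ∃ K₀ : ℝ, 1 ≤ K₀ ∧ ∀ K : ℝ, K₀ ≤ K →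
      ∀ (ν T t : ℝ) (u : ℝ → EuclideanSpace ℝ (Fin 3) → EuclideanSpace ℝ (Fin 3))
        (p : ℝ → EuclideanSpace ℝ (Fin 3) → ℝ),
        0 < ν → 0 < T → IsClassicalNSSolutionOn (Ico 0 T) ν 0 u p → IsLerayHopfOn T ν 0 (u 0) u →
        HasRapidSpatialDecay (u 0) → 0 < t → t < T → ¬ HasSmoothExtensionPast ν 0 u T →
        ∀ (x₀ : EuclideanSpace ℝ (Fin 3)) (L V : ℝ)
          (Q : EuclideanSpace ℝ (Fin 3) ≃ₗᵢ[ℝ] EuclideanSpace ℝ (Fin 3)),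
          0 < L → 0 < V → (∀ x, ‖u t x‖ ≤ V) →
          (∃ x₁, dist x₁ x₀ ≤ L ∧ V ≤ 2 * ‖u t x₁‖) → K * ν ≤ L * V → (T - t) * V ≤ K * L →
          ∀ (v : ℝ → EuclideanSpace ℝ (Fin 3) → EuclideanSpace ℝ (Fin 3))
            (q : ℝ → EuclideanSpace ℝ (Fin 3) → ℝ) (Mv : ℝ),
            IsClassicalNSSolutionOn (Icc t T) ν 0 v q →
            (∀ s ∈ Icc t T, IsAxisymmetric (fun y : EuclideanSpace ℝ (Fin 3) => Q.symm (v s (x₀ + Q y)))) →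
            (∀ s ∈ Icc t T, ∀ x, ‖v s x‖ ≤ Mv) →
            (∀ x ∈ ball x₀ (K * L), ‖u t x - v t x‖ ≤ A * V / K) →
            ∃ M : ℝ, ∀ s ∈ Ico t T, ∀ x ∈ ball x₀ (K * L / 2), ‖u s x‖ ≤ M) := by
  constructor
  · intro h A hA
    obtain ⟨K₀, hK₀, hK⟩ := h A hA
    refine ⟨K₀, hK₀, ?_⟩
    intro K hKK ν T t u p hν hT hcl hLH hdec ht htT _ x₀ L V Q hL hV hbd hnear hRe hlate v q Mv hv hvax hvbd
      hclose
    exact hK K hKK ν T t u p hν hT hcl hLH hdec ht htT x₀ L V Q hL hV hbd hnear hRe hlate v q Mv hv hvax hvbd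
      hclose
  · intro h A hA
    obtain ⟨K₀, hK₀, hK⟩ := h A hA
    refine ⟨K₀, hK₀, ?_⟩
    intro K hKK ν T t u p hν hT hcl hLH hdec ht htT x₀ L V Q hL hV hbd hnear hRe hlate v q Mv hv hvax hvbd hclose
    by_cases hext : HasSmoothExtensionPast ν 0 u T
    · exact localBound_of_hasSmoothExtensionPast hext ht.le x₀ (K * L / 2)
    · exact hK K hKK ν T t u p hν hT hcl hLH hdec ht htT hext x₀ L V Q hL hV hbd hnear hRe hlate v q Mv hv
        hvax hvbd hclose

end CoreExclusionConsistency

end Summit.NavierStokesRegularity.NavierStokesRegularity.Theorems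

end
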